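/-
Copyright (c) 2026 The decomp-a2c cell (lens-4 «minimal counterexample / extremal reduction», g49 second node). All rights reserved.
Released under Apache 2.0 license as described in the file LICENSE.
-/
import Summits.AtomisticToContinuum.Crystallization.Theorems.OverbindingBudgetAffineFarRechart

/-!
# Overbinding budget · affine branch · slot Z — the SITEWISE KERNEL FORM of the inflow leaf (Z3k) with its double count PROVED

Sequel of `…OverbindingBudgetAffineFarRechart` (v8: the gauge quotient `Recharts`, the leaves Z3⁗ `RechartedTailTransferInf` and Z3b⁗
`RechartedInflowWallLaw`, seam v8, glue `TailDriftBound → RechartedInflowWallLaw → RechartedTailTransferInf`, six-leaf record).  Residual of record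
`stmt-AtomisticToContinuum-31280` (slot Z `FarAggregatePricing 12 (1/25) (1/2000) (1/(2·10⁷))`); this file touches ONLY the rank-2 L leaf Z3b⁗.

## The point
Turning the extremal lens on Z3b⁗ itself (memo COUNTEREX-g49-Z3b §9b: six attack families, all survive) isolates the mechanism that makes it true on
paper: the unmatched inflow of a normal far row under its best rechart is **two-defect-local** — a row loses matter only towards a SECOND foreign
coherent structure (the first is absorbed by the rechart), two different-axis coherent structures within distance `m` of a row conflict on a non-good
LINE within `≈ 1.73·m` of it (crossing) or end on a partial dislocation (termination), and the loss `≤ 0.135/m³` is dominated by that line's mass under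
the summable kernel `r⁻⁴` (`∫_line (D² + s²)⁻² ds = π/(2D³)`).  The aggregate wall law Z3b⁗ is therefore the DOUBLE COUNT of a SITEWISE statement with
an explicit kernel, and the double count is elementary (dyadic shells + the tree's volume packing `card_goodSet_filter_dist_le`).  This file types the
sitewise statement, PROVES the double count and the reduction, and so offers the cell a sharper, shelter-free, per-row-instrumentable form of the leaf:

* `defectKernel ρ₁ ε₁ θ δ y i := Σ_{k ∉ G} (nn_i / |y i − y k|)⁴` — the non-good sites seen from row `i` through the kernel `r⁻⁴` in units of the
  row's own nearest distance (each term `≤ 1` since `|y i − y k| ≥ nn_i`);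
* ★ `sum_kernelTerm_col_le` (PROVED): for `0 < δ ≤ 2` and every site `k`, `Σ_{i ∈ G} (nn_i/|y i − y k|)⁴ ≤ 2¹⁴/δ³` — good sites are `δ`-separated
  with `nn ≤ 2`, so the dyadic shell `2ʲ < r ≤ 2ʲ⁺¹` holds `≤ (2ʲ⁺²/δ + 1)³` of them at weight `≤ (2/2ʲ)⁴`;
* **Z3k · `SitewiseRechartLoss θ θ₀`** (NEW · TRUE-type on paper · UNDECIDED · ATTACKABLE-L · INSTRUMENTABLE PER ROW): R_aff ⇒ `∀ C ≥ 0, ∃ D C''' ε_W,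
  ∀ ε₁ ≤ ε_W, ∀ δ, ∃ A ≥ 0`, for every injective configuration, EVERY normal far row `i ∈ Far ∖ sb` (no shelter) and every admissible `Cε₁`-exact chart
  `c` of it there are a rechart `c'`, a matched set `M ⊆ G` and a matching `π` with `−smoothTail (G ∖ M) y i ≤ C'''·ε₁ + A·defectKernel 12 ε₁ θ δ y i`;
* ★ `rechartedInflowWallLaw_of_sitewise` (PROVED): `SitewiseRechartLoss θ θ₀ → RechartedInflowWallLaw θ θ₀` with `C_T := A·2¹⁴/δ³` (choose row by row,
  sum, exchange the double sum, apply the column bound) — hence `farAggregatePricing_record_of_six_leaves_sitewise`: slot Z from Z2, Zr‴a, Zr‴b, Z3a,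
  Z3k, Z4″ BY NAME through the landed v8 record.

Z3k is STRONGER than Z3b⁗ (sitewise ⇒ aggregate), not weaker: it is offered as a REDIRECT of the L leaf (glue proved, piece strictly weaker than the
summit, more attackable: no shelter radius, no `C_T`, one row at a time — a refuter tests it on a single row of a single texture, a prover proves it by
the local classification «1 or 4 admissible axes per core ball» + two-defect locality + crossing/termination cost), with Z3b⁗ remaining the coarse
alternative exactly as Z3⁗ is for Z3a ∧ Z3b⁗.  Might fail: a row whose second-nearest foreign structure conflicts with the nearest one only FAR from the
row (excluded on paper: close-packed families meet at the fixed angle `70.53°`), or a coherent everywhere-good planar structure that no rechart represents.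

Must-fail probes (lens folder `g49/bc/ProbeZ3k.lean`): Z3k outright; Z3k ⇒ slot Z alone; Z3b⁗ ⇒ Z3k by cheap tactics (it is genuinely stronger);
the column bound without the window (`δ`-separation) — all fail; Z3k ⇒ Z3b⁗, the six-leaf record and the tree cone BY NAME — elaborate.
-/

namespace Summit.AtomisticToContinuum.Crystallization.Theorems.OverbindingBudgetAffineFarSmoothSplit

open scoped BigOperators Classical
open Literature.MathematicalPhysics.StatisticalMechanics
open Literature.Geometry.DiscreteGeometry (nearestDist nearestDist_nonneg nearestDist_le_dist)
open Summit.AtomisticToContinuum.Crystallization.Theorems.OverbindingBudgetBalancedCensusStatements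
open Summit.AtomisticToContinuum.Crystallization.Theorems.OverbindingBudgetAffineLadder
open Summit.AtomisticToContinuum.Crystallization.Theorems.OverbindingBudgetAffineLocalisation

variable {N : ℕ}

local notation "E3" => EuclideanSpace ℝ (Fin 3)

/-! ## §1  The defect kernel and its column bound (PROVED) -/

/-- **The defect kernel seen from row `i`**: `Σ_{k ∉ G} (nn_i / |y i − y k|)⁴` — every NON-GOOD site weighted by the summable kernel `r⁻⁴` in units of
the row's own nearest distance.  A non-good line at distance `D` carrying `c` sites per `nn` contributes `≈ c·π/(2D³)`. -/
noncomputable def defectKernel (ρ₁ ε₁ θ δ : ℝ) (y : Fin N → E3) (i : Fin N) : ℝ :=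
  ∑ k ∈ (goodSet ρ₁ ε₁ θ δ y)ᶜ, (nearestDist y i / dist (y i) (y k)) ^ 4

/-- The defect kernel is non-negative. [this file] -/
theorem defectKernel_nonneg (ρ₁ ε₁ θ δ : ℝ) (y : Fin N → E3) (i : Fin N) : 0 ≤ defectKernel ρ₁ ε₁ θ δ y i :=
  Finset.sum_nonneg fun k _ => by positivity

/-- **Dyadic domination of one kernel term**: for `0 ≤ x ≤ 2`, `x ≤ d ≤ 2ᴶ⁺¹`,
`(x/d)⁴ ≤ Σ_{j ≤ J} (2/2ʲ)⁴ · 1{d ≤ 2ʲ⁺¹}` (the shell `2ʲ < d ≤ 2ʲ⁺¹`, or `j = 0` when `d ≤ 2`, already pays). [this file] -/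
theorem kernelTerm_le_dyadic {x d : ℝ} (hx0 : 0 ≤ x) (hx2 : x ≤ 2) (hxd : x ≤ d) {J : ℕ} (hdJ : d ≤ 2 ^ (J + 1)) :
    (x / d) ^ 4 ≤ ∑ j ∈ Finset.range (J + 1), (2 / 2 ^ j : ℝ) ^ 4 * (if d ≤ 2 ^ (j + 1) then 1 else 0) := by
  have hnn : ∀ j ∈ Finset.range (J + 1), (0 : ℝ) ≤ (2 / 2 ^ j : ℝ) ^ 4 * (if d ≤ 2 ^ (j + 1) then 1 else 0) :=
    fun j _ => by split_ifs <;> positivity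
  have hd0 : 0 ≤ d := hx0.trans hxd
  by_cases h2 : d ≤ 2
  · have h0mem : 0 ∈ Finset.range (J + 1) := Finset.mem_range.mpr (Nat.succ_pos J)
    refine le_trans ?_ (Finset.single_le_sum hnn h0mem)
    rw [if_pos (by simpa using h2), mul_one, pow_zero, div_one]
    by_cases hd : d = 0
    · rw [hd, div_zero]; norm_num
    · have hdpos : 0 < d := lt_of_le_of_ne hd0 (Ne.symm hd)
      have h1 : x / d ≤ 1 := (div_le_one hdpos).mpr hxd
      calc (x / d) ^ 4 ≤ 1 ^ 4 := pow_le_pow_left₀ (div_nonneg hx0 hd0) h1 4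
        _ ≤ 2 ^ 4 := by norm_num
  · have h2 : 2 < d := not_le.mp h2
    have hex : ∃ j : ℕ, d ≤ 2 ^ (j + 1) := ⟨J, hdJ⟩
    have hj₀ : d ≤ 2 ^ (Nat.find hex + 1) := Nat.find_spec hex
    have hj₀J : Nat.find hex ≤ J := Nat.find_le hdJ
    have hj₀pos : 0 < Nat.find hex := by
      rcases Nat.eq_zero_or_pos (Nat.find hex) with h | h
      · exfalso; rw [h] at hj₀; norm_num at hj₀; linarith
      · exact h
    have hlow : 2 ^ Nat.find hex < d := by
      have hmin := Nat.find_min hex (show Nat.find hex - 1 < Nat.find hex by omega)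
      rw [show Nat.find hex - 1 + 1 = Nat.find hex by omega] at hmin
      exact not_le.mp hmin
    have hmem : Nat.find hex ∈ Finset.range (J + 1) := Finset.mem_range.mpr (by omega)
    refine le_trans ?_ (Finset.single_le_sum hnn hmem)
    rw [if_pos hj₀, mul_one]
    have hdpos : 0 < d := by linarith
    have hT : (0 : ℝ) < 2 ^ Nat.find hex := by positivity
    refine pow_le_pow_left₀ (div_nonneg hx0 hd0) ?_ 4
    calc x / d ≤ 2 / d := div_le_div_of_nonneg_right hx2 hdpos.le
      _ ≤ 2 / 2 ^ Nat.find hex := div_le_div_of_nonneg_left (by norm_num) hT hlow.le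

/-- ★ **THE KERNEL DOUBLE COUNT (PROVED): every site is seen by the good class with total kernel weight `≤ 2¹⁴/δ³`** — for `0 < δ ≤ 2`, an injective
configuration and any site `k`, `Σ_{i ∈ G} (nn_i/|y i − y k|)⁴ ≤ 2¹⁴/δ³`: good sites are `δ`-separated with `nn ≤ 2` (`inWindow_of_mem_goodSet`), the
sites with `|y i − y k| ≤ 2ʲ⁺¹` number `≤ (2ʲ⁺²/δ + 1)³ ≤ (2ʲ⁺³/δ)³` (`card_goodSet_filter_dist_le`) at weight `≤ (2/2ʲ)⁴`, and `Σ_j 2¹³·2⁻ʲ ≤ 2¹⁴`.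
[this file] -/
theorem sum_kernelTerm_col_le {ρ₁ ε₁ θ δ : ℝ} (hδ : 0 < δ) (hδ2 : δ ≤ 2) {y : Fin N → E3} (hy : Function.Injective y) (k : Fin N) :
    ∑ i ∈ goodSet ρ₁ ε₁ θ δ y, (nearestDist y i / dist (y i) (y k)) ^ 4 ≤ 2 ^ 14 / δ ^ 3 := by
  set G := goodSet ρ₁ ε₁ θ δ y with hG
  -- a dyadic ceiling for the distances to `y k`
  obtain ⟨J, hJ⟩ : ∃ J : ℕ, ∀ i : Fin N, dist (y i) (y k) ≤ 2 ^ (J + 1) := by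
    obtain ⟨n, hn⟩ := pow_unbounded_of_one_lt (∑ i, dist (y i) (y k)) (by norm_num : (1 : ℝ) < 2)
    refine ⟨n, fun i => ?_⟩
    have h1 : dist (y i) (y k) ≤ ∑ i, dist (y i) (y k) :=
      Finset.single_le_sum (fun i _ => dist_nonneg) (Finset.mem_univ i)
    have h2 : (2 : ℝ) ^ n ≤ 2 ^ (n + 1) := pow_le_pow_right₀ (by norm_num) (Nat.le_succ n)
    linarith
  -- pointwise dyadic domination of each term
  have hdom : ∀ i ∈ G, (nearestDist y i / dist (y i) (y k)) ^ 4
      ≤ ∑ j ∈ Finset.range (J + 1), (2 / 2 ^ j : ℝ) ^ 4 * (if dist (y i) (y k) ≤ 2 ^ (j + 1) then 1 else 0) := by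
    intro i hi
    by_cases hik : i = k
    · have h0 : dist (y i) (y k) = 0 := by rw [hik, dist_self]
      rw [h0, div_zero]
      simp only [ne_eq, OfNat.ofNat_ne_zero, not_false_eq_true, zero_pow]
      exact Finset.sum_nonneg fun j _ => by split_ifs <;> positivity
    · exact kernelTerm_le_dyadic (nearestDist_nonneg y i) (inWindow_of_mem_goodSet hi).2
        (nearestDist_le_dist y (Ne.symm hik)) (hJ i)
  -- the shell weights against the packing count
  have hterm : ∀ j ∈ Finset.range (J + 1),
      (2 / 2 ^ j : ℝ) ^ 4 * (2 * 2 ^ (j + 1) / δ + 1) ^ 3 ≤ 2 ^ 13 / δ ^ 3 * (1 / 2 : ℝ) ^ j := by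
    intro j _
    have hT : (0 : ℝ) < 2 ^ j := by positivity
    have hT1 : (1 : ℝ) ≤ 2 ^ j := one_le_pow₀ (by norm_num)
    have h1 : 2 * 2 ^ (j + 1) / δ + 1 ≤ 8 * 2 ^ j / δ := by
      have h4 : (1 : ℝ) ≤ 4 * 2 ^ j / δ := by
        rw [le_div_iff₀ hδ]; linarith
      calc 2 * 2 ^ (j + 1) / δ + 1 = 4 * 2 ^ j / δ + 1 := by rw [pow_succ]; ring
        _ ≤ 4 * 2 ^ j / δ + 4 * 2 ^ j / δ := by linarith
        _ = 8 * 2 ^ j / δ := by ring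
    have h2 : (2 * 2 ^ (j + 1) / δ + 1) ^ 3 ≤ (8 * 2 ^ j / δ) ^ 3 := pow_le_pow_left₀ (by positivity) h1 3
    calc (2 / 2 ^ j : ℝ) ^ 4 * (2 * 2 ^ (j + 1) / δ + 1) ^ 3 ≤ (2 / 2 ^ j : ℝ) ^ 4 * (8 * 2 ^ j / δ) ^ 3 :=
          mul_le_mul_of_nonneg_left h2 (by positivity)
      _ = 2 ^ 13 / δ ^ 3 * (1 / 2 : ℝ) ^ j := by
          rw [div_pow, div_pow, one_div_pow]; field_simp; ring
  calc ∑ i ∈ G, (nearestDist y i / dist (y i) (y k)) ^ 4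
      ≤ ∑ i ∈ G, ∑ j ∈ Finset.range (J + 1), (2 / 2 ^ j : ℝ) ^ 4 * (if dist (y i) (y k) ≤ 2 ^ (j + 1) then 1 else 0) :=
        Finset.sum_le_sum hdom
    _ = ∑ j ∈ Finset.range (J + 1), (2 / 2 ^ j : ℝ) ^ 4 * ((G.filter fun i => dist (y i) (y k) ≤ 2 ^ (j + 1)).card : ℝ) := by
        rw [Finset.sum_comm]
        refine Finset.sum_congr rfl fun j _ => ?_
        rw [← Finset.mul_sum, Finset.sum_boole]
    _ ≤ ∑ j ∈ Finset.range (J + 1), (2 / 2 ^ j : ℝ) ^ 4 * (2 * 2 ^ (j + 1) / δ + 1) ^ 3 :=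
        Finset.sum_le_sum fun j _ => mul_le_mul_of_nonneg_left
          (card_goodSet_filter_dist_le hδ hy (y k) (by positivity)) (by positivity)
    _ ≤ ∑ j ∈ Finset.range (J + 1), 2 ^ 13 / δ ^ 3 * (1 / 2 : ℝ) ^ j := Finset.sum_le_sum hterm
    _ = 2 ^ 13 / δ ^ 3 * ∑ j ∈ Finset.range (J + 1), (1 / 2 : ℝ) ^ j := by rw [Finset.mul_sum]
    _ ≤ 2 ^ 13 / δ ^ 3 * 2 := mul_le_mul_of_nonneg_left (sum_geometric_two_le _) (by positivity)
    _ = 2 ^ 14 / δ ^ 3 := by ring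

/-- **The double count, aggregated**: `Σ_{i ∈ G} defectKernel ≤ 2¹⁴/δ³ · #Gᶜ` (exchange the sums, `sum_kernelTerm_col_le` column by column). [this file] -/
theorem sum_defectKernel_le {ρ₁ ε₁ θ δ : ℝ} (hδ : 0 < δ) (hδ2 : δ ≤ 2) {y : Fin N → E3} (hy : Function.Injective y) :
    ∑ i ∈ goodSet ρ₁ ε₁ θ δ y, defectKernel ρ₁ ε₁ θ δ y i ≤ 2 ^ 14 / δ ^ 3 * (((goodSet ρ₁ ε₁ θ δ y)ᶜ).card : ℝ) := by
  unfold defectKernel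
  rw [Finset.sum_comm]
  calc ∑ k ∈ (goodSet ρ₁ ε₁ θ δ y)ᶜ, ∑ i ∈ goodSet ρ₁ ε₁ θ δ y, (nearestDist y i / dist (y i) (y k)) ^ 4
      ≤ ∑ k ∈ (goodSet ρ₁ ε₁ θ δ y)ᶜ, (2 : ℝ) ^ 14 / δ ^ 3 := Finset.sum_le_sum fun k _ => sum_kernelTerm_col_le hδ hδ2 hy k
    _ = 2 ^ 14 / δ ^ 3 * (((goodSet ρ₁ ε₁ θ δ y)ᶜ).card : ℝ) := by rw [Finset.sum_const, nsmul_eq_mul, mul_comm]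

/-! ## §2  Z3k — the sitewise kernel form of the inflow leaf, and the reduction Z3k ⇒ Z3b⁗ (PROVED) -/

/-- **Z3k · `SitewiseRechartLoss θ θ₀`** (NEW · TRUE-type on paper · UNDECIDED · ATTACKABLE-L · INSTRUMENTABLE PER ROW; a REDIRECT of Z3b⁗ — stronger,
shelter-free, sitewise): R_aff ⇒ `∀ C ≥ 0, ∃ D C''' ε_W, ∀ ε₁ ≤ ε_W, ∀ δ ∈ (0,2], ∃ A ≥ 0` such that for every injective configuration, every normal
far row `i ∈ Far ∖ sb` and every admissible `Cε₁`-exact chart `c` of it there are a RECHART `c'` (`Recharts θ c c'`), a matched set `M ⊆ G` and a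
matching `π` (`Matched D ε₁`) with UNMATCHED INFLOW `−smoothTail (G ∖ M) y i ≤ C'''·ε₁ + A · defectKernel 12 ε₁ θ δ y i`.  Content (paper, memo
COUNTEREX-g49-Z3b §9b): the best rechart absorbs the nearest foreign coherent structure; the loss towards the second-nearest one at distance `m` is
`≤ 0.135/m³` and the two structures conflict on a non-good line within `≈ 1.73m` whose kernel mass is `≥ c·π/(2(1.73m)³) ≫ 0.135/m³`; finite faults end
on partials (non-good tubes); smooth `AffReg(ε₁)` drift overflows the cap by `≤ 4ε₁^{3/2} ≤ C'''ε₁`; rows near any non-good site are trivial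
(`defectKernel ≥ (nn_i/r₀)⁴`).  Might fail: a coherent everywhere-good planar structure that NO rechart represents, or two coherent structures near a row
whose conflict locus is far from it. -/
def SitewiseRechartLoss (θ θ₀ : ℝ) : Prop :=
  AffineChartStraightening → ∀ C : ℝ, 0 ≤ C → ∃ D C''' εW : ℝ, 0 ≤ D ∧ 0 ≤ C''' ∧ 0 < εW ∧
    ∀ ε₁ : ℝ, 0 < ε₁ → ε₁ ≤ εW → ∀ δ : ℝ, 0 < δ → δ ≤ 2 → ∃ A : ℝ, 0 ≤ A ∧
      ∀ (N : ℕ) (y : Fin N → E3), Function.Injective y →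
        ∀ i ∈ farSet θ₀ 12 ε₁ θ δ y \ goodScaleBadSet 12 ε₁ θ δ y, ∀ c : Chart, IsChart C ε₁ y i c → ChartAdmissible θ c →
          ∃ (c' : Chart) (M : Finset (Fin N)) (π : Fin N → E3),
            Recharts θ c c' ∧ M ⊆ goodSet 12 ε₁ θ δ y ∧ Matched D ε₁ y i c' M π ∧
            -smoothTail (goodSet 12 ε₁ θ δ y \ M) y i ≤ C''' * ε₁ + A * defectKernel 12 ε₁ θ δ y i

/-- ★ **Z3k ⇒ Z3b⁗ (PROVED): the wall law is the double count of the sitewise kernel form** — choose the rechart and the matching row by row on `Sh_R ⊆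
Far ∖ sb`, sum, bound `Σ_{Sh} defectKernel ≤ Σ_G defectKernel ≤ 2¹⁴/δ³·#Gᶜ` (`sum_defectKernel_le`): `C_T := A·2¹⁴/δ³`. [this file] -/
theorem rechartedInflowWallLaw_of_sitewise {θ θ₀ : ℝ} (h : SitewiseRechartLoss θ θ₀) : RechartedInflowWallLaw θ θ₀ := by
  intro hR C hC R hR0
  obtain ⟨D, C''', εW, hD, hC''', hεW, hmain⟩ := h hR C hC
  refine ⟨D, C''', εW, hD, hC''', hεW, fun ε₁ hε₁ hε₁W δ hδ hδ2 => ?_⟩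
  obtain ⟨A, hA, hsite⟩ := hmain ε₁ hε₁ hε₁W δ hδ hδ2
  refine ⟨A * (2 ^ 14 / δ ^ 3), by positivity, fun N y hy F hF => ?_⟩
  set G := goodSet 12 ε₁ θ δ y with hG
  set Sh := shelteredFarSet R θ₀ 12 ε₁ θ δ y with hSh
  have hch : ∀ i : Fin N, ∃ (c' : Chart) (M : Finset (Fin N)) (π : Fin N → E3), i ∈ Sh →
      Recharts θ (F i) c' ∧ M ⊆ G ∧ Matched D ε₁ y i c' M π ∧
        -smoothTail (G \ M) y i ≤ C''' * ε₁ + A * defectKernel 12 ε₁ θ δ y i := by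
    intro i
    by_cases hi : i ∈ Sh
    · obtain ⟨c', M, π, h1, h2, h3, h4⟩ :=
        hsite N y hy i (shelteredFarSet_subset R θ₀ 12 ε₁ θ δ y hi) (F i) (hF i hi).1 (hF i hi).2
      exact ⟨c', M, π, fun _ => ⟨h1, h2, h3, h4⟩⟩
    · exact ⟨F i, ∅, fun _ => 0, fun h1 => absurd h1 hi⟩
  choose F' M π hF' using hch
  refine ⟨F', M, π, fun i hi => ⟨(hF' i hi).1, (hF' i hi).2.1, (hF' i hi).2.2.1⟩, ?_⟩
  have hSG : Sh ⊆ G :=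
    (shelteredFarSet_subset R θ₀ 12 ε₁ θ δ y).trans (Finset.sdiff_subset.trans (farSet_subset_goodSet θ₀ 12 ε₁ θ δ y))
  have hsumK : ∑ i ∈ Sh, defectKernel 12 ε₁ θ δ y i ≤ 2 ^ 14 / δ ^ 3 * ((Gᶜ.card : ℕ) : ℝ) :=
    le_trans (Finset.sum_le_sum_of_subset_of_nonneg hSG fun i _ _ => defectKernel_nonneg 12 ε₁ θ δ y i)
      (sum_defectKernel_le hδ hδ2 hy)
  calc ∑ i ∈ Sh, -smoothTail (G \ M i) y i ≤ ∑ i ∈ Sh, (C''' * ε₁ + A * defectKernel 12 ε₁ θ δ y i) :=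
        Finset.sum_le_sum fun i hi => (hF' i hi).2.2.2
    _ = C''' * ε₁ * (Sh.card : ℝ) + A * ∑ i ∈ Sh, defectKernel 12 ε₁ θ δ y i := by
        rw [Finset.sum_add_distrib, Finset.sum_const, nsmul_eq_mul, Finset.mul_sum]; ring
    _ ≤ C''' * ε₁ * (Sh.card : ℝ) + A * (2 ^ 14 / δ ^ 3 * ((Gᶜ.card : ℕ) : ℝ)) :=
        add_le_add le_rfl (mul_le_mul_of_nonneg_left hsumK hA)
    _ = A * (2 ^ 14 / δ ^ 3) * ((Gᶜ.card : ℕ) : ℝ) + C''' * ε₁ * (Sh.card : ℝ) := by ring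

/-- **Z3k ⇒ Z3b⁗ at the parameters of record** `(θ, θ₀) = (1/25, 1/2000)`. [this file] -/
theorem rechartedInflowWallLaw_record_of_sitewise (h : SitewiseRechartLoss (1 / 25) (1 / 2000)) :
    RechartedInflowWallLaw (1 / 25) (1 / 2000) :=
  rechartedInflowWallLaw_of_sitewise h

/-- **Z3a ∧ Z3k ⇒ Z3⁗ at the parameters of record** (through the landed v8 glue `rechartedTailTransferInf_record_of_drift_wall`). [this file] -/
theorem rechartedTailTransferInf_record_of_drift_sitewise (ha : TailDriftBound (1 / 25) (1 / 2000))
    (hk : SitewiseRechartLoss (1 / 25) (1 / 2000)) : RechartedTailTransferInf (1 / 25) (1 / 2000) :=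
  rechartedTailTransferInf_record_of_drift_wall ha (rechartedInflowWallLaw_of_sitewise hk)

/-- ★ **SLOT Z FROM THE SIX LEAVES WITH THE SITEWISE KERNEL FORM (PROVED):
`FarCoreExcess ∧ ShelteredFarCharting ∧ NormalCorePricing ∧ TailDriftBound ∧ SitewiseRechartLoss ∧ ScaleBadFloor ⇒ FarAggregatePricing 12 (1/25) (1/2000)
(1/(2·10⁷))`** — the landed v8 record `farAggregatePricing_record_of_six_leaves` with Z3b⁗ supplied by `rechartedInflowWallLaw_of_sitewise`. [this file] -/
theorem farAggregatePricing_record_of_six_leaves_sitewise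
    (h2 : FarCoreExcess (1 / 25) (1 / 2000) (1 / (2 * 10 ^ 7)))
    (hra : ShelteredFarCharting (1 / 25) (1 / 2000)) (hrb : NormalCorePricing (1 / 25))
    (h3a : TailDriftBound (1 / 25) (1 / 2000)) (h3k : SitewiseRechartLoss (1 / 25) (1 / 2000))
    (h4 : ScaleBadFloor (1 / 25) (1 / (2 * 10 ^ 7))) :
    FarAggregatePricing 12 (1 / 25) (1 / 2000) (1 / (2 * 10 ^ 7)) :=
  farAggregatePricing_record_of_six_leaves h2 hra hrb h3a (rechartedInflowWallLaw_of_sitewise h3k) h4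

end Summit.AtomisticToContinuum.Crystallization.Theorems.OverbindingBudgetAffineFarSmoothSplit
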